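import Summits.QuantumFields.YangMills.Theorems.BalabanUVNodesN07ConstraintLetterTangent
import HarnessLib

/-!
# NODE N07 — (b′): THE FRÉCHET DERIVATIVE OF def-Y's CONSTRAINT LETTER `C` (✓`Node00.COfRecord`, M2 file 3e′) AT `A′ = 0` VANISHES ON EVERY DIRECTION
# WHOSE PRESENTED FIELD IS TRACELESS (print's `𝔤ᶜ = 𝔰𝔩(N,ℂ)`-valued `A′`, [15] (51)) — the `fderiv` form of T-C1′ (✓`hasDerivAt_COfRecord_line_zero`)

Cell `pub-ymgap`, width seat `pub-ymgap-dag-n07-w3` (g25), INTENT-7 ∕ CLAIM-7.  `--kind proof --supports stmt-QuantumFields-27238 --as helper`; count-neutral.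
[15] = [Balaban1985Variational]; [B9] = [Balaban1985BackgroundPropagators]; [I] = [Balaban1987RG1].

WHAT.  def-Y's `C(A′) = (1/i) log(Ū^k_h(exp(iη_kA′)U₀)(Ū^kU₀)⋆) − Q_k(U₀)A′` is ℂ-analytic at `0` under the small-field guard of `U₀`
(✓`Node00.analyticAt_COfRecord_zero`), and along every HERMITIAN-traceless direction its line derivative at `0` vanishes (T-C1′, this seat's
✓`N07ConstraintLetterTangent.hasDerivAt_COfRecord_line_zero`).  Here the two are combined:
* §1 `fderiv_COfRecord_zero_apply_of_herm` — `fderiv ℂ C 0 A′ = 0` for Hermitian-traceless presented `A′` (chain rule along `t ↦ (t:ℂ)•A′`, evaluation at a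
  bond through lit's `NegSup.evalCLM`, uniqueness of the line derivative);
* §2 `exists_herm_add_I_smul_herm` — every `A′` with traceless presented field is `H₁ + i•H₂` INSIDE THE CARRIER `Space115Lit` with `Hᵢ` Hermitian-traceless
  (the Cartesian decomposition `X = ½(X+X⋆) + i·(½i(X⋆−X))`, fibrewise);
* §3 ★★★ **(b′) `fderiv_COfRecord_zero_apply_of_trace_eq_zero`** — `fderiv ℂ C 0 A′ = 0` for EVERY traceless presented `A′` (ℂ-linearity of `fderiv ℂ C 0`), and the
  composition form `fderiv_COfRecord_comp_zero_of_trace_eq_zero`: for ANY ℂ-linear `P` on the carrier with traceless presented values, `fderiv ℂ (C ∘ P) 0 = 0`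
  (def-Y's cure (iii) «`fderiv ℂ (COfRecord ∘ slProjLit) 0 = 0`» is the instance `P := slProjLit`).

HONEST LABELS.  Calculus ∕ linear-algebra identities at a guarded background; no estimate, no `|C(A′)| ≤ C₂|A′|²` bound, and NOTHING on the trace line `A′ = a•1`
(there `C` is LINEAR and `fderiv ℂ C 0 ≠ 0` in general — LOCATED on the cell bus, 2026-08-31).  Count-neutral; N07 NOT discharged; P0 ⟨26900⟩ OPEN; R4 is the
conditional finite-𝕋⁴ rung only.  Nothing here is a claim about the Yang–Mills mass gap (`Summit.QuantumFields`): finite torus, fixed `ε`; nothing continuum ∕ OS ∕ Clay.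
-/

set_option autoImplicit false

noncomputable section

open scoped Matrix Matrix.Norms.L2Operator ComplexConjugate Topology

namespace Summit.QuantumFields.YangMills.Theorems.N07ConstraintLetterFderiv

open Literature.MathematicalPhysics.QuantumFieldTheory.Balaban1983to89
open Literature.MathematicalPhysics.QuantumFieldTheory.Balaban1983to89.T4Continuum (T4Family)
open T4Continuum BlockAveraging
open B11Eq115Space (NegSize NegSup JetSup levWeight)
open Node00
open Summit.QuantumFields.YangMills.Theorems.N07ConstraintLetterTangent (hasDerivAt_COfRecord_line_zero)

variable {N : ℕ} [NeZero N]

section Record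

variable (F : T4Family) {K : ℕ} (k : ℕ) (Ω : ℕ → Set (Site (F.P K) 0)) (U₀ : GaugeField (F.P K) 0 (SU N)) (levB : PBond (F.P K) k → ℕ)
  [Fact (0 < (F.L : ℝ))] [Fact (0 < (F.P K).eta k)]

/-! ## §1  `fderiv ℂ C 0 A′ = 0` along Hermitian-traceless presented directions -/

/-- **THE LINE `t ↦ C((t:ℂ)•A′)` HAS DERIVATIVE `fderiv ℂ C 0 A′` AT `t = 0`** (chain rule through def-Y's analyticity of `C` at `0`, guarded `U₀`), read at a bond `c`.
[cite: Balaban1985Variational, Sect. G p.307, (44) p.285] -/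
theorem hasDerivAt_COfRecord_line_fderiv (hU₀ : SmallBelow (avOfRecord F N K) k U₀) (A : Space115Lit F N K k Ω U₀) (c : PBond (F.P K) k) :
    HasDerivAt (fun t : ℝ => NegSup.equiv _ _ (COfRecord F N K k Ω U₀ levB ((t : ℂ) • A)) c)
      (NegSup.equiv _ _ (fderiv ℂ (COfRecord F N K k Ω U₀ levB) 0 A) c) 0 := by
  have hd : HasFDerivAt (COfRecord F N K k Ω U₀ levB) (fderiv ℂ (COfRecord F N K k Ω U₀ levB) 0) 0 :=
    (analyticAt_COfRecord_zero F N k Ω U₀ levB hU₀).differentiableAt.hasFDerivAt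
  have hline : HasDerivAt (fun t : ℝ => (t : ℂ) • A) A 0 := by
    have h := (Complex.ofRealCLM.hasDerivAt (x := (0 : ℝ))).smul_const A
    rw [Complex.ofRealCLM_apply, Complex.ofReal_one, one_smul] at h
    exact h
  have hcomp := (hd.restrictScalars ℝ).comp_hasDerivAt_of_eq (0 : ℝ) hline (by rw [Complex.ofReal_zero, zero_smul])
  have hev := ((NegSup.evalCLM ℂ (V := Matrix (Fin N) (Fin N) ℂ) (levWeight (F.L : ℝ) ((F.P K).eta k) levB 0) c).restrictScalars ℝ).hasFDerivAt.comp_hasDerivAt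
    (0 : ℝ) hcomp
  exact hev

/-- ★ **`fderiv ℂ C 0 A′ = 0` FOR EVERY `A′` WHOSE PRESENTED FIELD IS HERMITIAN AND TRACELESS** (guarded `U₀`): the line derivative of §1's chain rule is the one of
T-C1′, which is `0` (`HasDerivAt.unique`). [cite: Balaban1985Variational, (44) p.285, (19) p.281, (51) p.286; Balaban1985BackgroundPropagators, (3.13) p.393] -/
theorem fderiv_COfRecord_zero_apply_of_herm (hU₀ : SmallBelow (avOfRecord F N K) k U₀) (A : Space115Lit F N K k Ω U₀)
    (hH : ∀ b, star (evLit F N K k Ω U₀ A b) = evLit F N K k Ω U₀ A b) (htr : ∀ b, (evLit F N K k Ω U₀ A b).trace = 0) :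
    fderiv ℂ (COfRecord F N K k Ω U₀ levB) 0 A = 0 := by
  refine (NegSup.equiv _ _).injective (funext fun c => ?_)
  rw [NegSup.equiv_zero, Pi.zero_apply]
  exact (hasDerivAt_COfRecord_line_fderiv F k Ω U₀ levB hU₀ A c).unique (hasDerivAt_COfRecord_line_zero F k Ω U₀ levB hU₀ A hH htr c)

/-! ## §2  The Cartesian decomposition inside the carrier: traceless `A′ = H₁ + i•H₂` with `Hᵢ` Hermitian-traceless -/

omit [NeZero N] [Fact (0 < (F.L : ℝ))] [Fact (0 < (F.P K).eta k)] in
/-- **THE HERMITIAN PART OF A JET, IN THE CARRIER**: `H₁ := ½(A′ + A′⋆)` fibrewise, an element of `Space115Lit` whose presented field is Hermitian, and traceless where `A′` is.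
[cite: Balaban1985Variational, (19) p.281, (51) p.286, (115) p.294] -/
theorem evLit_hermPart (A : Space115Lit F N K k Ω U₀) (b : PBond (F.P K) 0) :
    evLit F N K k Ω U₀ ((JetSup.equiv _ _ _).symm fun a => (2 : ℂ)⁻¹ • (JetSup.equiv _ _ _ A a + star (JetSup.equiv _ _ _ A a))) b =
      (2 : ℂ)⁻¹ • (evLit F N K k Ω U₀ A b + star (evLit F N K k Ω U₀ A b)) := rfl

omit [NeZero N] [Fact (0 < (F.L : ℝ))] [Fact (0 < (F.P K).eta k)] in
/-- **THE SKEW PART OF A JET DIVIDED BY `i`, IN THE CARRIER**: `H₂ := ½·i(A′⋆ − A′)` fibrewise. [cite: Balaban1985Variational, (19) p.281, (51) p.286, (115) p.294] -/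
theorem evLit_skewPart (A : Space115Lit F N K k Ω U₀) (b : PBond (F.P K) 0) :
    evLit F N K k Ω U₀ ((JetSup.equiv _ _ _).symm fun a => (2 : ℂ)⁻¹ • (Complex.I • (star (JetSup.equiv _ _ _ A a) - JetSup.equiv _ _ _ A a))) b =
      (2 : ℂ)⁻¹ • (Complex.I • (star (evLit F N K k Ω U₀ A b) - evLit F N K k Ω U₀ A b)) := rfl

omit [NeZero N] in
/-- `(½(X + X⋆))⋆ = ½(X + X⋆)`. [folklore] -/
theorem star_hermPart (X : Matrix (Fin N) (Fin N) ℂ) : star ((2 : ℂ)⁻¹ • (X + star X)) = (2 : ℂ)⁻¹ • (X + star X) := by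
  rw [star_smul, star_add, star_star, add_comm (star X) X, Complex.star_def, map_inv₀, map_ofNat]

omit [NeZero N] in
/-- `(½·i(X⋆ − X))⋆ = ½·i(X⋆ − X)`. [folklore] -/
theorem star_skewPart (X : Matrix (Fin N) (Fin N) ℂ) :
    star ((2 : ℂ)⁻¹ • (Complex.I • (star X - X))) = (2 : ℂ)⁻¹ • (Complex.I • (star X - X)) := by
  rw [star_smul, star_smul, star_sub, star_star, Complex.star_def, map_inv₀, map_ofNat, Complex.conj_I, neg_smul, ← smul_neg, neg_sub]

omit [NeZero N] in
/-- `tr ½(X + X⋆) = 0` when `tr X = 0`. [folklore] -/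
theorem trace_hermPart {X : Matrix (Fin N) (Fin N) ℂ} (hX : X.trace = 0) : ((2 : ℂ)⁻¹ • (X + star X)).trace = 0 := by
  rw [Matrix.trace_smul, Matrix.trace_add, Matrix.star_eq_conjTranspose, Matrix.trace_conjTranspose, hX, star_zero, add_zero, smul_zero]

omit [NeZero N] in
/-- `tr ½·i(X⋆ − X) = 0` when `tr X = 0`. [folklore] -/
theorem trace_skewPart {X : Matrix (Fin N) (Fin N) ℂ} (hX : X.trace = 0) : ((2 : ℂ)⁻¹ • (Complex.I • (star X - X))).trace = 0 := by
  rw [Matrix.trace_smul, Matrix.trace_smul, Matrix.trace_sub, Matrix.star_eq_conjTranspose, Matrix.trace_conjTranspose, hX, star_zero, sub_zero,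
    smul_zero, smul_zero]

omit [NeZero N] in
/-- The Cartesian identity `X = ½(X + X⋆) + i·(½·i(X⋆ − X))`. [folklore] -/
theorem hermPart_add_I_smul_skewPart (X : Matrix (Fin N) (Fin N) ℂ) :
    (2 : ℂ)⁻¹ • (X + star X) + Complex.I • ((2 : ℂ)⁻¹ • (Complex.I • (star X - X))) = X := by
  have hI : Complex.I * (2 : ℂ)⁻¹ * Complex.I = -(2 : ℂ)⁻¹ := by
    rw [mul_right_comm, Complex.I_mul_I]; ring
  rw [smul_smul, smul_smul, hI]
  module

omit [NeZero N] [Fact (0 < (F.L : ℝ))] [Fact (0 < (F.P K).eta k)] in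
/-- ★ **EVERY JET WITH TRACELESS PRESENTED FIELD IS `H₁ + i•H₂` IN THE CARRIER `Space115Lit`, `H₁`, `H₂` WITH HERMITIAN TRACELESS PRESENTED FIELDS** (print's
`𝔤ᶜ = 𝔤 ⊕ i𝔤` fibrewise, (51)). [cite: Balaban1985Variational, (51) p.286, (19) p.281, (115) p.294] -/
theorem exists_herm_add_I_smul_herm (A : Space115Lit F N K k Ω U₀) (htr : ∀ b, (evLit F N K k Ω U₀ A b).trace = 0) :
    ∃ H₁ H₂ : Space115Lit F N K k Ω U₀,
      (∀ b, star (evLit F N K k Ω U₀ H₁ b) = evLit F N K k Ω U₀ H₁ b) ∧ (∀ b, (evLit F N K k Ω U₀ H₁ b).trace = 0) ∧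
      (∀ b, star (evLit F N K k Ω U₀ H₂ b) = evLit F N K k Ω U₀ H₂ b) ∧ (∀ b, (evLit F N K k Ω U₀ H₂ b).trace = 0) ∧
      A = H₁ + Complex.I • H₂ := by
  refine ⟨(JetSup.equiv _ _ _).symm fun a => (2 : ℂ)⁻¹ • (JetSup.equiv _ _ _ A a + star (JetSup.equiv _ _ _ A a)),
    (JetSup.equiv _ _ _).symm fun a => (2 : ℂ)⁻¹ • (Complex.I • (star (JetSup.equiv _ _ _ A a) - JetSup.equiv _ _ _ A a)),
    fun b => ?_, fun b => ?_, fun b => ?_, fun b => ?_, ?_⟩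
  · rw [evLit_hermPart]; exact star_hermPart _
  · rw [evLit_hermPart]; exact trace_hermPart (htr b)
  · rw [evLit_skewPart]; exact star_skewPart _
  · rw [evLit_skewPart]; exact trace_skewPart (htr b)
  · refine (JetSup.equiv _ _ _).injective (funext fun a => ?_)
    exact (hermPart_add_I_smul_skewPart (JetSup.equiv _ _ _ A a)).symm

/-! ## §3  (b′): `fderiv ℂ C 0 A′ = 0` for every traceless presented direction, and the composition form -/

/-- ★★★ **(b′): `fderiv ℂ C 0 A′ = 0` FOR EVERY `A′` WHOSE PRESENTED FIELD IS TRACELESS** (print's `𝔤ᶜ`-valued directions (51)) at a guarded background — §1 on the two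
Hermitian-traceless parts of §2 and ℂ-linearity of `fderiv ℂ C 0`.  (On the trace line nothing is claimed: there `C` is linear.)
[cite: Balaban1985Variational, (44) p.285, (51) p.286; Balaban1985BackgroundPropagators, (3.13) p.393] -/
theorem fderiv_COfRecord_zero_apply_of_trace_eq_zero (hU₀ : SmallBelow (avOfRecord F N K) k U₀) (A : Space115Lit F N K k Ω U₀)
    (htr : ∀ b, (evLit F N K k Ω U₀ A b).trace = 0) : fderiv ℂ (COfRecord F N K k Ω U₀ levB) 0 A = 0 := by
  obtain ⟨H₁, H₂, hH₁, htr₁, hH₂, htr₂, hA⟩ := exists_herm_add_I_smul_herm F k Ω U₀ A htr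
  rw [hA, map_add, map_smul, fderiv_COfRecord_zero_apply_of_herm F k Ω U₀ levB hU₀ H₁ hH₁ htr₁,
    fderiv_COfRecord_zero_apply_of_herm F k Ω U₀ levB hU₀ H₂ hH₂ htr₂, smul_zero, add_zero]

/-- ★★ **THE COMPOSITION FORM: for ANY ℂ-linear `P` on the carrier whose presented values are traceless, `fderiv ℂ (C ∘ P) 0 = 0`** (guarded `U₀`) — def-Y's
cure (iii) is the instance `P :=` the fibrewise traceless projection. [cite: Balaban1985Variational, (44) p.285, (51) p.286, Sect. G p.307] -/
theorem fderiv_COfRecord_comp_zero_of_trace_eq_zero (hU₀ : SmallBelow (avOfRecord F N K) k U₀)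
    (P : Space115Lit F N K k Ω U₀ →L[ℂ] Space115Lit F N K k Ω U₀) (hP : ∀ A b, (evLit F N K k Ω U₀ (P A) b).trace = 0) :
    fderiv ℂ (COfRecord F N K k Ω U₀ levB ∘ P) 0 = 0 := by
  have hd : DifferentiableAt ℂ (COfRecord F N K k Ω U₀ levB) (P 0) := by
    rw [map_zero]; exact (analyticAt_COfRecord_zero F N k Ω U₀ levB hU₀).differentiableAt
  rw [fderiv_comp 0 hd P.differentiableAt, P.fderiv, map_zero]
  ext A
  rw [ContinuousLinearMap.comp_apply, zero_apply]
  exact fderiv_COfRecord_zero_apply_of_trace_eq_zero F k Ω U₀ levB hU₀ (P A) (hP A)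

/-- ★★ **`HasFDerivAt (C ∘ P) 0 0`** for any such `P` (guarded `U₀`) — the `HasFDerivAt` packaging of the composition form. [cite: Balaban1985Variational, (44) p.285, (51) p.286] -/
theorem hasFDerivAt_COfRecord_comp_zero (hU₀ : SmallBelow (avOfRecord F N K) k U₀)
    (P : Space115Lit F N K k Ω U₀ →L[ℂ] Space115Lit F N K k Ω U₀) (hP : ∀ A b, (evLit F N K k Ω U₀ (P A) b).trace = 0) :
    HasFDerivAt (COfRecord F N K k Ω U₀ levB ∘ P) (0 : Space115Lit F N K k Ω U₀ →L[ℂ] _) 0 := by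
  have hd : DifferentiableAt ℂ (COfRecord F N K k Ω U₀ levB) (P 0) := by
    rw [map_zero]; exact (analyticAt_COfRecord_zero F N k Ω U₀ levB hU₀).differentiableAt
  have h := (hd.comp 0 P.differentiableAt).hasFDerivAt
  rwa [fderiv_COfRecord_comp_zero_of_trace_eq_zero F k Ω U₀ levB hU₀ P hP] at h

/-- `C ∘ P` vanishes at `0` for any linear `P` (guarded `U₀`; def-Y's `COfRecord_zero`). [cite: Balaban1985Variational, (44) p.285] -/
theorem COfRecord_comp_zero (hU₀ : SmallBelow (avOfRecord F N K) k U₀) (P : Space115Lit F N K k Ω U₀ →L[ℂ] Space115Lit F N K k Ω U₀) :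
    (COfRecord F N K k Ω U₀ levB ∘ P) 0 = 0 := by
  rw [Function.comp_apply, map_zero, COfRecord_zero F N k Ω U₀ levB hU₀]

end Record

end Summit.QuantumFields.YangMills.Theorems.N07ConstraintLetterFderiv
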